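/- Free-seat work of WIDTH SEAT 2/3 `ym-line-cbag-p1-w2` (prover-ym-line-cbag-p1-w2-g16-0), route `EguchiKawaiDirectionLadder`
(ideator ym-idea-2, LINE 8), crux `DirectionIncrement` (stmt-QuantumFields-27725), stub B1 `SingleLinkRigidity`: the BLOCK CHOICE from
centre symmetry — input (BLOCKS) of the reduction `singleLinkRigidity_of_blocks_of_offDiagSmallBall` — PROVED (part 3/3).
ROUTE-INDEPENDENT (no Theses import).  B1 itself is NOT proved here and nothing bears on the YM mass gap. -/
import Summits.QuantumFields.YangMills.Theorems.EguchiKawaiDirectionLadderSingleLinkBlocksCounting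

/-!
# Stub B1 of crux `DirectionIncrement`: the block choice from centre symmetry (BLOCKS), proved

`blocks_from_centre_symmetry`: for `0 < δ < 1/2` there are `m = ⌈16/δ⌉` and `γ = 2 − 2cos(2π/m²) > 0` such that every
unit-modulus spectrum `d : Fin N → ℂ` with `|Σ_j d_j / N|² ≤ δ` (centre symmetry of `U = V·diag(d)·V⁻¹`, `|tr U/N|² ≤ δ`) admits a
labelling `ℓ : Fin N → Option (Fin m)` of the indices by `m` blocks (`none` = free index) with

* SEPARATION: `|d_j − d_k|² ≥ γ` whenever `j, k` carry different blocks;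
* COUNT: `#{(j,k) : ℓ j ≠ ℓ k, both labelled}/2 ≥ ((1 − 2δ)/4)·N²` (i.e. `Σ_{i<i'} n_i n_{i'} ≥ ((1−2δ)/4)N²`).

This is exactly the hypothesis (BLOCKS) of `singleLinkRigidity_of_blocks_of_offDiagSmallBall`
(`EguchiKawaiDirectionLadderSingleLinkReductionCore.lean`); with it, stub B1 — hence the crux `DirectionIncrement` — hinges on the single
random-matrix input (RMT): the `N`-uniform Hilbert–Schmidt small-ball bound for off-diagonal blocks of a Haar unitary.
Parameters: `M = m = ⌈16/δ⌉` (so `1/m ≤ δ/16`, `1 − cos(π/m) ≤ π²/(2m²) ≤ δ/50`), shift `r` by `exists_shift_few_collars`, labels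
`blockLabel m m r (d j)`; the count by `pairCount_lower_bounds` and the real arithmetic `blocks_final_ineq` (extremal case: two antipodal
clusters of weights `(1 ± √δ)/2`, `Σ_{i<i'} n_i n_{i'}/N² → (1 − δ)/4 > (1 − 2δ)/4`).

HONEST FRAMING.  Deterministic, `N`-free combinatorics; the probabilistic content of B1 (RMT) is untouched.  Barrier-ledger line
(`EguchiKawaiBreakdown`); nothing here bears on the Yang–Mills mass gap.
-/

set_option autoImplicit false

noncomputable section

open scoped Real
open Finset

namespace Summit.QuantumFields.YangMills.Theorems.EguchiKawaiDirectionLadder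

/-! ### E. Assembly: the block choice from centre symmetry -/

/-- The polynomial inequality behind the exponent count (case of one dominant block). -/
theorem blocks_key_poly {s e : ℝ} (hs0 : 0 ≤ s) (hs1 : s ≤ 3 / 4) (he0 : 0 ≤ e) (he1 : e ≤ s ^ 2 / 50) :
    (1 - 2 * s ^ 2) * (2 - e) ^ 2 ≤ 4 * (1 + s) * ((1 - s ^ 2 / 16) * (2 - e) - (1 + s)) := by
  nlinarith [mul_nonneg he0 hs0, sq_nonneg e, sq_nonneg s, mul_nonneg he0 (sq_nonneg s),
    mul_nonneg (mul_nonneg he0 hs0) hs0, mul_nonneg (mul_nonneg he0 he0) (sq_nonneg s),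
    mul_nonneg he0 he0, mul_nonneg (mul_nonneg he0 hs0) (sq_nonneg s)]

/-- The real-arithmetic core of the exponent count: from `T ≥ N(1 − δ/16)` labelled indices, a largest block of size
`x₁ ≤ N(1+√δ)/(1+cos(π/m))` (`1 + cos(π/m) = 2 − e`, `e ≤ δ/50`) and the two pair-count lower bounds, `pc/2 ≥ ((1−2δ)/4)·N²`. -/
theorem blocks_final_ineq {δ s e Nr T x₁ pc : ℝ} (hδ : 0 < δ) (hδ' : δ < 1 / 2) (hs0 : 0 ≤ s) (hs2 : s ^ 2 = δ)
    (he0 : 0 ≤ e) (he1 : e ≤ δ / 50) (hN : 0 ≤ Nr) (hT1 : T ≤ Nr) (hT2 : Nr * (1 - δ / 16) ≤ T)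
    (hx0 : 0 ≤ x₁) (hxT : x₁ ≤ T) (hxc : x₁ * (2 - e) ≤ Nr * (1 + s))
    (hpc1 : T * (T - x₁) ≤ pc) (hpc2 : 2 * x₁ * (T - x₁) ≤ pc) :
    (1 - 2 * δ) / 4 * Nr ^ 2 ≤ pc / 2 := by
  have hs1 : s ≤ 3 / 4 := by nlinarith
  subst hs2
  have hT0 : 0 ≤ T := le_trans (by nlinarith) hT2
  by_cases hx : 2 * x₁ ≤ T
  · -- pc ≥ T²/2
    have h1 : T * T / 2 ≤ pc := by nlinarith
    have h2 : Nr * (1 - s ^ 2 / 16) * (Nr * (1 - s ^ 2 / 16)) ≤ T * T :=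
      mul_self_le_mul_self (by nlinarith) hT2
    nlinarith
  · push Not at hx
    have he2 : 0 < 2 - e := by nlinarith
    set A : ℝ := Nr * (1 + s) / (2 - e) with hA
    have hxA : x₁ ≤ A := by rw [hA, le_div_iff₀ he2]; exact hxc
    have hA0 : 0 ≤ A := by rw [hA]; positivity
    have hAle : A ≤ Nr * (1 - s ^ 2 / 16) := by
      rw [hA, div_le_iff₀ he2]
      have : (1 + s) ≤ (1 - s ^ 2 / 16) * (2 - e) := by nlinarith
      nlinarith
    have hAT : A ≤ T := hAle.trans hT2
    have hmono : A * (T - A) ≤ x₁ * (T - x₁) := by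
      nlinarith [mul_nonneg (sub_nonneg.2 hxA) (by linarith : 0 ≤ A + x₁ - T)]
    have hA2 : A * (Nr * (1 - s ^ 2 / 16) - A) ≤ A * (T - A) := by nlinarith
    have hkey : (1 - 2 * s ^ 2) / 4 * Nr ^ 2 ≤ A * (Nr * (1 - s ^ 2 / 16) - A) := by
      have hp := blocks_key_poly hs0 hs1 he0 he1
      rw [hA]
      rw [show Nr * (1 + s) / (2 - e) * (Nr * (1 - s ^ 2 / 16) - Nr * (1 + s) / (2 - e)) =
        Nr ^ 2 * ((1 + s) * ((1 - s ^ 2 / 16) * (2 - e) - (1 + s))) / (2 - e) ^ 2 by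
          field_simp]
      rw [le_div_iff₀ (by positivity)]
      have hN2 : 0 ≤ Nr ^ 2 := sq_nonneg Nr
      nlinarith [mul_le_mul_of_nonneg_left hp hN2]
    linarith


/-- **(BLOCKS) — the block choice from centre symmetry, PROVED.**  For `0 < δ < 1/2` there are `m` (`= ⌈16/δ⌉`) and `γ > 0`
(`= 2 − 2cos(2π/m²)`) such that every unit-modulus spectrum `d : Fin N → ℂ` with `|Σ_j d_j / N|² ≤ δ` admits a labelling
`ℓ : Fin N → Option (Fin m)` by `m` blocks with `|d_j − d_k|² ≥ γ` across blocks and at least `((1 − 2δ)/4)·N²` unordered pairs of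
indices in different blocks.  (Fine cells of width `2π/m²`, one collar cell in `m` chosen by pigeonhole over the shift, arcs of
`m` cells; an arc of angular width `2π/m` carries at most `N(1+√δ)/(1+cos(π/m))` points by centre symmetry.) -/
theorem blocks_from_centre_symmetry (δ : ℝ) (hδ : 0 < δ) (hδ' : δ < 1 / 2) :
    ∃ m : ℕ, ∃ γ : ℝ, 0 < γ ∧ ∀ N : ℕ, ∀ d : Fin N → ℂ,
      (∀ j, ‖d j‖ = 1) → ‖(∑ j, d j) / (N : ℂ)‖ ^ 2 ≤ δ → ∃ ℓ : Fin N → Option (Fin m),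
        (∀ j k, ℓ j ≠ ℓ k → ℓ j ≠ none → ℓ k ≠ none → γ ≤ ‖d j - d k‖ ^ 2) ∧
          (1 - 2 * δ) / 4 * (N : ℝ) ^ 2 ≤
            ((Finset.univ.filter fun p : Fin N × Fin N => ℓ p.1 ≠ ℓ p.2 ∧ ℓ p.1 ≠ none ∧ ℓ p.2 ≠ none).card : ℝ) / 2 := by
  -- parameters
  set m : ℕ := ⌈16 / δ⌉₊ with hmdef
  have hm16 : 16 / δ ≤ (m : ℝ) := Nat.le_ceil _
  have h16 : (32 : ℝ) < 16 / δ := by rw [lt_div_iff₀ hδ]; nlinarith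
  have hmR : (32 : ℝ) < m := h16.trans_le hm16
  have hm : 0 < m := by exact_mod_cast (show (0 : ℝ) < m by linarith)
  have hK : 0 < m * m := Nat.mul_pos hm hm
  set γ : ℝ := 2 - 2 * Real.cos (2 * π / (m * m : ℕ)) with hγ
  have hγpos : 0 < γ := by
    have hKR : (0 : ℝ) < (m * m : ℕ) := by exact_mod_cast hK
    have hx0 : 0 < 2 * π / (m * m : ℕ) := by positivity
    have hx1 : 2 * π / (m * m : ℕ) < 2 * π := by
      rw [div_lt_iff₀ hKR]
      have : (1 : ℝ) < (m * m : ℕ) := by push_cast; nlinarith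
      nlinarith [Real.pi_pos]
    have hne : Real.cos (2 * π / (m * m : ℕ)) ≠ 1 := by
      rw [Ne, Real.cos_eq_one_iff_of_lt_of_lt (by linarith) hx1]
      exact hx0.ne'
    have hle := Real.cos_le_one (2 * π / (m * m : ℕ))
    rw [hγ]
    have := lt_of_le_of_ne hle hne
    linarith
  refine ⟨m, γ, hγpos, fun N d hd hsum => ?_⟩
  -- the shift with few collars
  obtain ⟨r, hrM, hcollar⟩ := exists_shift_few_collars (m := m) (M := m) hK d
  have hr : r < m * m := lt_of_lt_of_le hrM (Nat.le_mul_of_pos_left m hm)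
  refine ⟨fun j => blockLabel m m r (d j), fun j k hne h1 h2 => blockLabel_separated hr (hd j) (hd k) hne h1 h2, ?_⟩
  set ℓ : Fin N → Option (Fin m) := fun j => blockLabel m m r (d j) with hℓ
  -- a largest block
  obtain ⟨a₁, -, ha₁⟩ := Finset.exists_max_image Finset.univ
    (fun a : Fin m => (Finset.univ.filter fun k => ℓ k = some a).card) ⟨⟨0, hm⟩, Finset.mem_univ _⟩
  have hmax : ∀ j, ℓ j ≠ none →
      (Finset.univ.filter fun k => ℓ k = ℓ j).card ≤ (Finset.univ.filter fun k => ℓ k = some a₁).card := by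
    intro j hj
    obtain ⟨a, ha⟩ := Option.ne_none_iff_exists'.1 hj
    rw [ha]; exact ha₁ a (Finset.mem_univ a)
  obtain ⟨hLB1, hLB2⟩ := pairCount_lower_bounds ℓ (some a₁) (Option.some_ne_none a₁) hmax
  set T : ℝ := ((Finset.univ.filter fun k => ℓ k ≠ none).card : ℝ) with hT
  set x₁ : ℝ := ((Finset.univ.filter fun k => ℓ k = some a₁).card : ℝ) with hx₁
  set pc : ℝ := ((Finset.univ.filter fun p : Fin N × Fin N => ℓ p.1 ≠ ℓ p.2 ∧ ℓ p.1 ≠ none ∧ ℓ p.2 ≠ none).card : ℝ)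
    with hpc
  -- x₁ (1 + cos(π/m)) ≤ N + |Σ d| ≤ N (1 + √δ)
  have hx₁c : x₁ * (1 + Real.cos (π / m)) ≤ N + ‖∑ j, d j‖ := card_blockLabel_eq_some_le hm hr d hd a₁
  have hnorm : ‖∑ j, d j‖ ≤ N * Real.sqrt δ := by
    rcases Nat.eq_zero_or_pos N with hN | hN
    · subst hN; simp
    · have hNR : (0 : ℝ) < N := by exact_mod_cast hN
      have h1 : ‖(∑ j, d j) / (N : ℂ)‖ ≤ Real.sqrt δ := by
        rw [Real.le_sqrt (norm_nonneg _) hδ.le]; exact hsum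
      rw [norm_div, Complex.norm_natCast, div_le_iff₀ hNR] at h1
      linarith
  -- T ≥ N (1 − δ/16)
  have hTB : T + ((Finset.univ.filter fun j => blockLabel m m r (d j) = none).card : ℝ) = N := by
    have h := Finset.card_filter_add_card_filter_not (s := (Finset.univ : Finset (Fin N))) (fun k => ℓ k = none)
    rw [Finset.card_univ, Fintype.card_fin, add_comm] at h
    rw [hT]; exact_mod_cast h
  have hNR0 : (0 : ℝ) ≤ N := Nat.cast_nonneg N
  have hT2 : (N : ℝ) * (1 - δ / 16) ≤ T := by
    have hB : ((Finset.univ.filter fun j => blockLabel m m r (d j) = none).card : ℝ) * m ≤ N := hcollar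
    have hB' : ((Finset.univ.filter fun j => blockLabel m m r (d j) = none).card : ℝ) ≤ N * (δ / 16) := by
      have hmpos : (0 : ℝ) < m := by linarith
      have : ((Finset.univ.filter fun j => blockLabel m m r (d j) = none).card : ℝ) ≤ N / m := by
        rw [le_div_iff₀ hmpos]; exact hB
      refine this.trans ?_
      rw [div_le_iff₀ hmpos]
      have : (N : ℝ) ≤ N * (δ / 16) * m := by
        have h3 : (1 : ℝ) ≤ δ / 16 * m := by
          have := mul_le_mul_of_nonneg_left hm16 (show (0:ℝ) ≤ δ / 16 by positivity)
          rwa [show δ / 16 * (16 / δ) = 1 by field_simp] at this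
        nlinarith
      linarith
    linarith
  have hT1 : T ≤ N := by
    have : (0 : ℝ) ≤ ((Finset.univ.filter fun j => blockLabel m m r (d j) = none).card : ℝ) := Nat.cast_nonneg _
    linarith
  have hxT : x₁ ≤ T := by
    rw [hx₁, hT]
    exact_mod_cast Finset.card_le_card (fun k hk => by
      rw [Finset.mem_filter] at hk ⊢; exact ⟨hk.1, hk.2 ▸ Option.some_ne_none a₁⟩)
  -- e = 1 − cos(π/m) ≤ δ/50
  set e : ℝ := 1 - Real.cos (π / m) with he
  have he0 : 0 ≤ e := by rw [he]; linarith [Real.cos_le_one (π / m)]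
  have he1 : e ≤ δ / 50 := by
    have h1 : e ≤ (π / m) ^ 2 / 2 := by rw [he]; linarith [Real.one_sub_sq_div_two_le_cos (x := π / m)]
    have hmpos : (0 : ℝ) < m := by linarith
    have h2 : π / m ≤ 3.15 * (δ / 16) := by
      rw [div_le_iff₀ hmpos]
      have h3 : (1 : ℝ) ≤ δ / 16 * m := by
        have := mul_le_mul_of_nonneg_left hm16 (show (0:ℝ) ≤ δ / 16 by positivity)
        rwa [show δ / 16 * (16 / δ) = 1 by field_simp] at this
      nlinarith [Real.pi_lt_d2, Real.pi_pos]
    have h4 : (π / m) ^ 2 ≤ (3.15 * (δ / 16)) ^ 2 := pow_le_pow_left₀ (by positivity) h2 2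
    nlinarith
  have hxc : x₁ * (2 - e) ≤ N * (1 + Real.sqrt δ) := by
    rw [he]; nlinarith
  exact blocks_final_ineq hδ hδ' (Real.sqrt_nonneg δ) (Real.sq_sqrt hδ.le) he0 he1 hNR0 hT1 hT2 (Nat.cast_nonneg _) hxT hxc
    hLB1 hLB2
end Summit.QuantumFields.YangMills.Theorems.EguchiKawaiDirectionLadder

end
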